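import Summits.QuantumFields.YangMills.Theorems.UnitScaleTiltProp7CutoffMassFormRows
import Summits.QuantumFields.YangMills.Theorems.UnitScaleTiltProp7CutoffResolventComparison
import Summits.QuantumFields.YangMills.Theorems.UnitScaleTiltProp7TopMeanTwoBackgrounds
import HarnessLib

/-!
# Route `UnitScaleTilt`, crux K1 «MinimiserStabilityRegPr» (stmt-QuantumFields-19200), EX row `hGF[Lift]` (curved member) — **LOD LINE, PEN (L5″) (RB1) MEMBER KNIT:
# THE TWO MASSIVE PROPAGATORS ON A CUT-OFF VECTOR** — routeR-w3 g12's 2b-door row `hRB1 : ‖G_W h − G_1 h‖ ≤ c_G‖h‖` (`χh = h`) of ✓`Prop7ColumnPairingRows.sqrt_sum_normSq_inner_column_sub_le`,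
assembled from px5's letters: the FORM ROW of ✓`Prop7CutoffMassFormRows.abs_re_inner_twisted_massive_le` (p752370) — its two-tower rows `hQw`∕`hQz` now THEOREMS by
✓`Prop7TopMeanTwoBackgrounds` (p754749) — converted from gauge-parameter fields to `L²` vectors (`toL2S` is a linear equivalence) and read against ABSTRACT massive operators
`A_U w = Δ_U w + a·TU(ι(QU w))`, `A_V w = Δ_V w + a·T(ι(Q'' w))` (§1); then ✓`Prop7CutoffResolventComparison.norm_inv_cutoff_comm_le_of_form` (p750050 §4) twice — at `(U, V)` and at
`(V, V)` — and the triangle `G_U h − G_V h = (G_U(Xh) − X(G_V h)) + (X(G_V h) − G_V(Xh))` for `Xh = h` (§2, abstract; = 2b-door's `norm_sub_le_of_cutoff_fixed`).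

Cell `ym3-torus` (HUMAN RULING D-0037, YM ladder rung R3 — NOT d = 4, NOT infinite volume, NOT a mass gap, NOT Clay).  Width seat `ym3-torus-px5` gen 11; ★p1 g24 LOCATE-L6-ASSEMBLY
§1 Step I.2 (L5″), road (α); routeR-w3 g12 2026-08-30 00:44:48Z (RB1)∕(RB2).  THEOREMS ONLY (0 `def`, 0 `sorry`); `--supports stmt-QuantumFields-19200 --as helper`, count-neutral.
HONEST LABEL (★★OWNER RULING №33 (6)): curved γ-row supplier line (LOD localisation), pen (L5″); a knit — displayed data: the cut-off geometry (`θ`, `θ′`, `|χ| ≤ 1`), `‖U♭ − V♭‖ ≤ δη`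
on the bonds meeting `supp χ`, the frame rows on the blocks meeting `supp χ`, and the abstract propagator data (inverses, coercivity `m_U, m_V`, energy); nothing of (3.49), Thm 3.1∕3.3,
`h349`, `hGF`, EX ∕ 19200 is proved here.

References: T. Bałaban, CMP **99** (1985) 389–434 [Balaban1985BackgroundPropagators] (Thm 3.3 p.399, (3.49) p.399, (3.100)–(3.105) pp.413–414, (3.24) p.394); CMP **98** (1985)
17–51 [Balaban1985Averaging] ((97) p.32).
-/

set_option autoImplicit false

noncomputable section

open scoped BigOperators Matrix.Norms.L2Operator InnerProductSpace ComplexConjugate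

namespace Summit.QuantumFields.YangMills.Theorems.Prop7PropagatorComparisonOnCutoff

open Literature.MathematicalPhysics.QuantumFieldTheory.Balaban1983to89
open T4Continuum BlockAveraging
open BlockAveraging (Idx)
open B7Prop1Explicit (disp)
open B5Eq118OneStroke (iterBlockOf iterBlock)
open B15DeterminingSets (embIter)
open B10Eq27TorusAxialLog (holT axialT transl)
open B7TransferAnalyticMean (meanCLM)
open B11Eq103H1Complex (SiteL2K)
open Summit.QuantumFields.YangMills.Theorems.Prop8Chart (emlIterU)
open Literature.MathematicalPhysics.QuantumFieldTheory.Balaban1983to89.T3ContinuumYM3Torus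
open T3SectALandauChart (eta bgUnits)
open T3PrintedRegularMinimiser (RegPr)
open T3PrintedRegularOrbits (sites_eq)
open T3LevelShift (siteShift)
open Summit.QuantumFields.YangMills.Theorems.Prop7SectET3Transport (periodsT3)
open Summit.QuantumFields.YangMills.Theorems.Prop7SectET3HilbertLetters (W₂ toL2S DL2 covLapSite)
open Summit.QuantumFields.YangMills.Theorems.Prop7CutoffMassFormRows (abs_re_inner_twisted_massive_le)
open Summit.QuantumFields.YangMills.Theorems.Prop7CutoffResolventComparison (norm_inv_cutoff_comm_le_of_form)
open Summit.QuantumFields.YangMills.Theorems.Prop7TopMeanTwoBackgrounds (norm_lift_topMean_sub_le norm_inner_lift_topMean_sub_le)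

/-! ## §2 first (abstract): two cut-off resolvent comparisons and a triangle -/

section Abstract

variable {E F F' : Type*} [NormedAddCommGroup E] [InnerProductSpace ℂ E] [NormedAddCommGroup F] [InnerProductSpace ℂ F]
  [NormedAddCommGroup F'] [InnerProductSpace ℂ F']

/-- ★★ **(RB1), ABSTRACT**: two positive systems `A_U`, `A_V` with inverses `G_U`, `G_V`, coercivity `m_U`, `m_V`, energies `‖D_U w‖² ≤ re⟪w, A_U w⟫`, `‖D w‖² ≤ re⟪w, A_V w⟫`, and
the two form rows — `(U,V)`: `|re⟪z, X(A_V w) − A_U(X w)⟫| ≤ (c₁′‖Dw‖ + c₀′‖w‖)(‖D_U z‖ + ‖z‖)`, `(V,V)`: `|re⟪z, X(A_V w) − A_V(X w)⟫| ≤ (c₁″‖Dw‖ + c₀″‖w‖)(‖D z‖ + ‖z‖)` — give, for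
every `h` fixed by the cut-off (`Xh = h`): `‖G_U h − G_V h‖ ≤ (√(m_U⁻¹)(1 + √(m_U⁻¹))(c₁′√(m_V⁻¹) + c₀′m_V⁻¹) + √(m_V⁻¹)(1 + √(m_V⁻¹))(c₁″√(m_V⁻¹) + c₀″m_V⁻¹))·‖h‖`
(✓`norm_inv_cutoff_comm_le_of_form` twice + `G_U h − G_V h = (G_U(Xh) − X(G_V h)) + (X(G_V h) − G_V(Xh))`). [cite: Balaban1985BackgroundPropagators, Thm 3.3 p.399, (3.105) p.414] -/
theorem norm_inv_sub_inv_le_of_cutoff_fixed (AU AV GU GV X : E →ₗ[ℂ] E) (DU : E →ₗ[ℂ] F') (D : E →ₗ[ℂ] F)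
    (hUG : ∀ v, AU (GU v) = v) (hAG : ∀ v, AV (GV v) = v) (hGA : ∀ v, GU (AU v) = v) (hGAV : ∀ v, GV (AV v) = v)
    {mU mV : ℝ} (hmU : 0 < mU) (hmV : 0 < mV)
    (hcoU : ∀ u : E, mU * ‖u‖ ^ 2 ≤ RCLike.re ⟪u, AU u⟫_ℂ) (hcoV : ∀ u : E, mV * ‖u‖ ^ 2 ≤ RCLike.re ⟪u, AV u⟫_ℂ)
    (henergyU : ∀ w : E, ‖DU w‖ ^ 2 ≤ RCLike.re ⟪w, AU w⟫_ℂ) (henergy : ∀ w : E, ‖D w‖ ^ 2 ≤ RCLike.re ⟪w, AV w⟫_ℂ)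
    {c₁' c₀' c₁'' c₀'' : ℝ} (hc₁' : 0 ≤ c₁') (hc₀' : 0 ≤ c₀') (hc₁'' : 0 ≤ c₁'') (hc₀'' : 0 ≤ c₀'')
    (hformUV : ∀ z w : E, |RCLike.re ⟪z, X (AV w) - AU (X w)⟫_ℂ| ≤ (c₁' * ‖D w‖ + c₀' * ‖w‖) * (‖DU z‖ + ‖z‖))
    (hformVV : ∀ z w : E, |RCLike.re ⟪z, X (AV w) - AV (X w)⟫_ℂ| ≤ (c₁'' * ‖D w‖ + c₀'' * ‖w‖) * (‖D z‖ + ‖z‖))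
    (h : E) (hXh : X h = h) :
    ‖GU h - GV h‖ ≤ (Real.sqrt mU⁻¹ * (1 + Real.sqrt mU⁻¹) * (c₁' * Real.sqrt mV⁻¹ + c₀' * mV⁻¹)
        + Real.sqrt mV⁻¹ * (1 + Real.sqrt mV⁻¹) * (c₁'' * Real.sqrt mV⁻¹ + c₀'' * mV⁻¹)) * ‖h‖ := by
  have h1 := (norm_inv_cutoff_comm_le_of_form AU AV GU GV X DU D hUG hAG hGA hmU hmV hcoU hcoV henergyU henergy hc₁' hc₀' hformUV h).2
  have h2 := (norm_inv_cutoff_comm_le_of_form AV AV GV GV X D D hAG hAG hGAV hmV hmV hcoV hcoV henergy henergy hc₁'' hc₀'' hformVV h).2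
  have e : GU h - GV h = (GU (X h) - X (GV h)) + (X (GV h) - GV (X h)) := by rw [hXh]; abel
  rw [e]
  calc ‖(GU (X h) - X (GV h)) + (X (GV h) - GV (X h))‖ ≤ ‖GU (X h) - X (GV h)‖ + ‖X (GV h) - GV (X h)‖ := norm_add_le _ _
    _ ≤ Real.sqrt mU⁻¹ * (1 + Real.sqrt mU⁻¹) * ((c₁' * Real.sqrt mV⁻¹ + c₀' * mV⁻¹) * ‖h‖)
        + Real.sqrt mV⁻¹ * (1 + Real.sqrt mV⁻¹) * ((c₁'' * Real.sqrt mV⁻¹ + c₀'' * mV⁻¹) * ‖h‖) := by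
        rw [norm_sub_rev (X (GV h))]; exact add_le_add h1 h2
    _ = _ := by ring

end Abstract

/-! ## §1 The member's form rows, on `L²` vectors and against abstract massive operators -/

variable (F : T3Family) {n K : ℕ} (h : n ≤ K) {c₀ c₁ : ℝ} [Fact (0 < c₀)] [Fact (0 < c₁)] {ε₀ : ℝ} (hε₀ : 0 < ε₀) (hε7 : 10 ^ 7 * (F.L : ℝ) ^ 3 * ε₀ ≤ 1)
  (V : GaugeField (F.P K) 0 (Matrix.specialUnitaryGroup (Fin 2) ℂ)) (hreg : RegPr F n K ε₀ V)
  (Q'' : SiteL2K ℂ 3 (periodsT3 F K) c₀ W₂ →ₗ[ℂ] (Site (F.P K) (K - n) → Matrix (Fin 2) (Fin 2) ℂ))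
  (hseq : ∀ lam : Site (F.P K) 0 → Matrix (Fin 2) (Fin 2) ℂ, ∃ ns : (j : ℕ) → Site (F.P K) j → Matrix (Fin 2) (Fin 2) ℂ, ns 0 = lam ∧
        (∀ (j : ℕ) (y : Site (F.P K) (j + 1)), ns (j + 1) y = ns j (emb y) - meanCLM (Idx (F.P K)) (Matrix (Fin 2) (Fin 2) ℂ) fun i : Idx (F.P K) =>
          ns j (emb y) - ((holT (emlIterU j (bgUnits F K V)) (emb y) (stairWord i.2.1 (off i.1)) : (Matrix (Fin 2) (Fin 2) ℂ)ˣ) : Matrix (Fin 2) (Fin 2) ℂ) *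
            ns j (transl (emb y) (disp (stairWord i.2.1 (off i.1)))) * (((holT (emlIterU j (bgUnits F K V)) (emb y) (stairWord i.2.1 (off i.1)))⁻¹ : (Matrix (Fin 2) (Fin 2) ℂ)ˣ) : Matrix (Fin 2) (Fin 2) ℂ)) ∧
        ns (K - n) = Q'' (toL2S F K c₀ lam))
  (ι : (Site (F.P K) (K - n) → Matrix (Fin 2) (Fin 2) ℂ) →ₗ[ℂ] SiteL2K ℂ 3 (periodsT3 F n) c₁ W₂)
  (hι : ∀ c, ι c = toL2S F n c₁ (fun z => c (siteShift (sites_eq F n K h) z)))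
  (T : SiteL2K ℂ 3 (periodsT3 F n) c₁ W₂ →ₗ[ℂ] SiteL2K ℂ 3 (periodsT3 F K) c₀ W₂)
  (hT : ∀ (l : SiteL2K ℂ 3 (periodsT3 F K) c₀ W₂) (f : SiteL2K ℂ 3 (periodsT3 F n) c₁ W₂), ⟪ι (Q'' l), f⟫_ℂ = ⟪l, T f⟫_ℂ)
  (U : GaugeField (F.P K) 0 (Matrix.specialUnitaryGroup (Fin 2) ℂ)) (hregU : RegPr F n K ε₀ U)
  (QU : SiteL2K ℂ 3 (periodsT3 F K) c₀ W₂ →ₗ[ℂ] (Site (F.P K) (K - n) → Matrix (Fin 2) (Fin 2) ℂ))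
  (hseqU : ∀ lam : Site (F.P K) 0 → Matrix (Fin 2) (Fin 2) ℂ, ∃ ns : (j : ℕ) → Site (F.P K) j → Matrix (Fin 2) (Fin 2) ℂ, ns 0 = lam ∧
        (∀ (j : ℕ) (y : Site (F.P K) (j + 1)), ns (j + 1) y = ns j (emb y) - meanCLM (Idx (F.P K)) (Matrix (Fin 2) (Fin 2) ℂ) fun i : Idx (F.P K) =>
          ns j (emb y) - ((holT (emlIterU j (bgUnits F K U)) (emb y) (stairWord i.2.1 (off i.1)) : (Matrix (Fin 2) (Fin 2) ℂ)ˣ) : Matrix (Fin 2) (Fin 2) ℂ) *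
            ns j (transl (emb y) (disp (stairWord i.2.1 (off i.1)))) * (((holT (emlIterU j (bgUnits F K U)) (emb y) (stairWord i.2.1 (off i.1)))⁻¹ : (Matrix (Fin 2) (Fin 2) ℂ)ˣ) : Matrix (Fin 2) (Fin 2) ℂ)) ∧
        ns (K - n) = QU (toL2S F K c₀ lam))
  (TU : SiteL2K ℂ 3 (periodsT3 F n) c₁ W₂ →ₗ[ℂ] SiteL2K ℂ 3 (periodsT3 F K) c₀ W₂)
  (hTU : ∀ (l : SiteL2K ℂ 3 (periodsT3 F K) c₀ W₂) (f : SiteL2K ℂ 3 (periodsT3 F n) c₁ W₂), ⟪ι (QU l), f⟫_ℂ = ⟪l, TU f⟫_ℂ)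

include h hε₀ hε7 hreg hseq hι hT hregU hseqU hTU in
/-- ★★★ **THE `(U,V)` FORM ROW ON `L²` VECTORS, TWO-TOWER ROWS DISCHARGED**: under the cut-off geometry of ✓`abs_re_inner_twisted_massive_le` (`|χ| ≤ 1`, bond steps `θ`,
in-block oscillation `θ′` about `χc`, `‖U♭ − V♭‖ ≤ δη` on the bonds meeting `supp χ`) and the FRAME ROWS `‖C^V − 1‖ ≤ δ_V`, `‖C^U − 1‖ ≤ δ_U` on the blocks meeting `supp χ`
(✓`Prop7TopMeanTwoBackgrounds`: they give `hQw`∕`hQz` with `δ_Q = √(2κ)(9000L²ε₀ + 2δ_V + 2δ_U)`), for ABSTRACT operators with `A_V w = Δ_V w + a·T(ι(Q'' w))`,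
`A_U w = Δ_U w + a·TU(ι(QU w))` and a cut-off `X` reading `χ·`: for all `z w : L²`,
`|re⟪z, X(A_V w) − A_U(X w)⟫| ≤ (c‖D_V w‖ + (c + a((25κ∕4)θ′ + 2√(25κ∕8)δ_Q))‖w‖)·(‖D_U z‖ + ‖z‖)`, `c = √3η⁻¹θ + √24δ + 2(√3η⁻¹θ)(√24δ)`.
[cite: Balaban1985BackgroundPropagators, Thm 3.3 p.399, (3.100)-(3.105) pp.413-414, (3.24) p.394; Balaban1985Averaging, (97) p.32] -/
theorem hform_massive (χ : Site (F.P K) 0 → ℝ) (χc : Site (F.P K) (K - n) → ℝ) {θ θ' δ : ℝ} (hθ : 0 ≤ θ) (hθ' : 0 ≤ θ') (hδ : 0 ≤ δ)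
    (hχ1 : ∀ x, |χ x| ≤ 1) (hχ : ∀ (x : Site (F.P K) 0) (μ : Fin 3), |χ (x.shift μ) - χ x| ≤ θ)
    (hχblk : ∀ x : Site (F.P K) 0, |χ x - χc (iterBlockOf (K - n) x)| ≤ θ')
    (hUV : ∀ b : PBond (F.P K) 0, (χ b.tgt ≠ 0 ∨ χ b.src ≠ 0) →
      ‖((bgUnits F K U b : (Matrix (Fin 2) (Fin 2) ℂ)ˣ) : Matrix (Fin 2) (Fin 2) ℂ) - ((bgUnits F K V b : (Matrix (Fin 2) (Fin 2) ℂ)ˣ) : Matrix (Fin 2) (Fin 2) ℂ)‖ ≤ δ * eta F n K)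
    {δV δU : ℝ} (hδV : 0 ≤ δV) (hδU : 0 ≤ δU)
    (hCV : ∀ Y : Site (F.P K) (K - n), (∃ x ∈ iterBlock (K - n) Y, χ x ≠ 0) → ∀ x ∈ iterBlock (K - n) Y, ‖(((axialT (bgUnits F K V) (Site.fibreSite 0 (K - n) (iterBlockOf (K - n) x) fun _ => (⟨0, pow_pos (F.P K).L_pos (K - n)⟩ : Fin ((F.P K).L ^ (K - n)))) (embIter (K - n) Y))⁻¹ *
          axialT (bgUnits F K V) (Site.fibreSite 0 (K - n) (iterBlockOf (K - n) x) fun _ => (⟨0, pow_pos (F.P K).L_pos (K - n)⟩ : Fin ((F.P K).L ^ (K - n)))) x : (Matrix (Fin 2) (Fin 2) ℂ)ˣ) : Matrix (Fin 2) (Fin 2) ℂ) - 1‖ ≤ δV)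
    (hCU : ∀ Y : Site (F.P K) (K - n), (∃ x ∈ iterBlock (K - n) Y, χ x ≠ 0) → ∀ x ∈ iterBlock (K - n) Y, ‖(((axialT (bgUnits F K U) (Site.fibreSite 0 (K - n) (iterBlockOf (K - n) x) fun _ => (⟨0, pow_pos (F.P K).L_pos (K - n)⟩ : Fin ((F.P K).L ^ (K - n)))) (embIter (K - n) Y))⁻¹ *
          axialT (bgUnits F K U) (Site.fibreSite 0 (K - n) (iterBlockOf (K - n) x) fun _ => (⟨0, pow_pos (F.P K).L_pos (K - n)⟩ : Fin ((F.P K).L ^ (K - n)))) x : (Matrix (Fin 2) (Fin 2) ℂ)ˣ) : Matrix (Fin 2) (Fin 2) ℂ) - 1‖ ≤ δU)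
    {a : ℝ} (ha : 0 ≤ a)
    (X : SiteL2K ℂ 3 (periodsT3 F K) c₀ W₂ →ₗ[ℂ] SiteL2K ℂ 3 (periodsT3 F K) c₀ W₂) (hX : ∀ l : Site (F.P K) 0 → Matrix (Fin 2) (Fin 2) ℂ, X (toL2S F K c₀ l) = toL2S F K c₀ (fun x => χ x • l x))
    (AU AV : SiteL2K ℂ 3 (periodsT3 F K) c₀ W₂ →ₗ[ℂ] SiteL2K ℂ 3 (periodsT3 F K) c₀ W₂)
    (hAV : ∀ w, AV w = covLapSite F n K c₀ V w + (a : ℂ) • T (ι (Q'' w)))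
    (hAU : ∀ w, AU w = covLapSite F n K c₀ U w + (a : ℂ) • TU (ι (QU w)))
    (z w : SiteL2K ℂ 3 (periodsT3 F K) c₀ W₂) :
    |RCLike.re ⟪z, X (AV w) - AU (X w)⟫_ℂ|
      ≤ ((Real.sqrt 3 * (eta F n K)⁻¹ * θ + Real.sqrt 24 * δ + 2 * (Real.sqrt 3 * (eta F n K)⁻¹ * θ) * (Real.sqrt 24 * δ)) * ‖DL2 F n K c₀ V w‖ + ((Real.sqrt 3 * (eta F n K)⁻¹ * θ + Real.sqrt 24 * δ + 2 * (Real.sqrt 3 * (eta F n K)⁻¹ * θ) * (Real.sqrt 24 * δ)) + a * ((25 / 4) * (c₁ * ((((F.P K).L : ℝ) ^ (F.P K).d) ^ (K - n))⁻¹ / c₀) * θ' + 2 * Real.sqrt ((25 / 8) * (c₁ * ((((F.P K).L : ℝ) ^ (F.P K).d) ^ (K - n))⁻¹ / c₀)) * (Real.sqrt (2 * (c₁ * ((((F.P K).L : ℝ) ^ (F.P K).d) ^ (K - n))⁻¹ / c₀)) * (2 * (4500 * (F.L : ℝ) ^ 2 * ε₀) + 2 * δV + 2 * δU)))) * ‖w‖)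 * (‖DL2 F n K c₀ U z‖ + ‖z‖) := by
  have hc₀ : 0 < c₀ := Fact.out
  have hc₁ : 0 < c₁ := Fact.out
  have hδQ : 0 ≤ (Real.sqrt (2 * (c₁ * ((((F.P K).L : ℝ) ^ (F.P K).d) ^ (K - n))⁻¹ / c₀)) * (2 * (4500 * (F.L : ℝ) ^ 2 * ε₀) + 2 * δV + 2 * δU)) := by have := (F.P K).L_pos; positivity
  have hQw := norm_lift_topMean_sub_le F hε₀ hε7 V hreg Q'' hseq U hregU QU hseqU h ι hι χ hχ1 hδV hδU hCV hCU
  have hQz := norm_inner_lift_topMean_sub_le F hε₀ hε7 V hreg Q'' hseq U hregU QU hseqU h ι hι χ hχ1 hδV hδU hCV hCU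
  have key := abs_re_inner_twisted_massive_le F h hε₀ hε7 V hreg Q'' hseq ι hι T hT U hregU QU hseqU TU hTU χ χc hθ hθ' hδ hδQ hχ1 hχ hχblk hUV
    hQw hQz ha X hX ((toL2S F K c₀).symm z) ((toL2S F K c₀).symm w)
  simp only [LinearEquiv.apply_symm_apply] at key
  rw [hAV w, hAU (X w)]
  exact key

include h hε₀ hε7 hreg hseq hι hT in
/-- ★★ **THE `(V,V)` FORM ROW** (same background on both sides: `‖V♭ − V♭‖ = 0`, `δ_Q = 0`): for all `z w : L²`,
`|re⟪z, X(A_V w) − A_V(X w)⟫| ≤ (c‖D_V w‖ + (c + a(25κ∕4)θ′)‖w‖)·(‖D_V z‖ + ‖z‖)` (✓`abs_re_inner_twisted_massive_le` at `U := V`).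
[cite: Balaban1985BackgroundPropagators, Thm 3.3 p.399, (3.100)-(3.105) pp.413-414] -/
theorem hform_massive_self (χ : Site (F.P K) 0 → ℝ) (χc : Site (F.P K) (K - n) → ℝ) {θ θ' δ : ℝ} (hθ : 0 ≤ θ) (hθ' : 0 ≤ θ') (hδ : 0 ≤ δ)
    (hχ1 : ∀ x, |χ x| ≤ 1) (hχ : ∀ (x : Site (F.P K) 0) (μ : Fin 3), |χ (x.shift μ) - χ x| ≤ θ)
    (hχblk : ∀ x : Site (F.P K) 0, |χ x - χc (iterBlockOf (K - n) x)| ≤ θ')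
    {a : ℝ} (ha : 0 ≤ a)
    (X : SiteL2K ℂ 3 (periodsT3 F K) c₀ W₂ →ₗ[ℂ] SiteL2K ℂ 3 (periodsT3 F K) c₀ W₂) (hX : ∀ l : Site (F.P K) 0 → Matrix (Fin 2) (Fin 2) ℂ, X (toL2S F K c₀ l) = toL2S F K c₀ (fun x => χ x • l x))
    (AV : SiteL2K ℂ 3 (periodsT3 F K) c₀ W₂ →ₗ[ℂ] SiteL2K ℂ 3 (periodsT3 F K) c₀ W₂) (hAV : ∀ w, AV w = covLapSite F n K c₀ V w + (a : ℂ) • T (ι (Q'' w)))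
    (z w : SiteL2K ℂ 3 (periodsT3 F K) c₀ W₂) :
    |RCLike.re ⟪z, X (AV w) - AV (X w)⟫_ℂ|
      ≤ ((Real.sqrt 3 * (eta F n K)⁻¹ * θ + Real.sqrt 24 * δ + 2 * (Real.sqrt 3 * (eta F n K)⁻¹ * θ) * (Real.sqrt 24 * δ)) * ‖DL2 F n K c₀ V w‖ + ((Real.sqrt 3 * (eta F n K)⁻¹ * θ + Real.sqrt 24 * δ + 2 * (Real.sqrt 3 * (eta F n K)⁻¹ * θ) * (Real.sqrt 24 * δ)) + a * ((25 / 4) * (c₁ * ((((F.P K).L : ℝ) ^ (F.P K).d) ^ (K - n))⁻¹ / c₀) * θ' + 2 * Real.sqrt ((25 / 8) * (c₁ * ((((F.P K).L : ℝ) ^ (F.P K).d) ^ (K - n))⁻¹ / c₀)) * 0)) * ‖w‖) * (‖DL2 F n K c₀ V z‖ + ‖z‖) := by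
  have hc₀ : 0 < c₀ := Fact.out
  have hc₁ : 0 < c₁ := Fact.out
  have hη : 0 < eta F n K := T3SectALandauChart.eta_pos F n K
  have hVV : ∀ b : PBond (F.P K) 0, (χ b.tgt ≠ 0 ∨ χ b.src ≠ 0) →
      ‖((bgUnits F K V b : (Matrix (Fin 2) (Fin 2) ℂ)ˣ) : Matrix (Fin 2) (Fin 2) ℂ) - ((bgUnits F K V b : (Matrix (Fin 2) (Fin 2) ℂ)ˣ) : Matrix (Fin 2) (Fin 2) ℂ)‖ ≤ δ * eta F n K := fun b _ => by
    rw [sub_self, norm_zero]; positivity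
  have hQw : ∀ y : Site (F.P K) 0 → Matrix (Fin 2) (Fin 2) ℂ,
      ‖ι (Q'' (toL2S F K c₀ (fun x => χ x • y x))) - ι (Q'' (toL2S F K c₀ (fun x => χ x • y x)))‖ ≤ 0 * ‖toL2S F K c₀ y‖ := fun y => by
    rw [sub_self, norm_zero, zero_mul]
  have hQz : ∀ y y' : Site (F.P K) 0 → Matrix (Fin 2) (Fin 2) ℂ,
      ‖⟪ι (Q'' (toL2S F K c₀ y)) - ι (Q'' (toL2S F K c₀ y)), ι (Q'' (toL2S F K c₀ (fun x => χ x • y' x)))⟫_ℂ‖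
        ≤ 0 * Real.sqrt ((25 / 8) * (c₁ * ((((F.P K).L : ℝ) ^ (F.P K).d) ^ (K - n))⁻¹ / c₀)) * ‖toL2S F K c₀ y‖ * ‖toL2S F K c₀ y'‖ := fun y y' => by
    rw [sub_self, inner_zero_left, norm_zero, zero_mul, zero_mul, zero_mul]
  have key := abs_re_inner_twisted_massive_le F h hε₀ hε7 V hreg Q'' hseq ι hι T hT V hreg Q'' hseq T hT χ χc hθ hθ' hδ le_rfl hχ1 hχ hχblk hVV
    hQw hQz ha X hX ((toL2S F K c₀).symm z) ((toL2S F K c₀).symm w)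
  simp only [LinearEquiv.apply_symm_apply] at key
  rw [hAV w, hAV (X w)]
  exact key

include h hε₀ hε7 hreg hseq hι hT hregU hseqU hTU in
/-- ★★★ **(RB1) AT THE MEMBER** — everything of §1 and §2 in one row: for `hh : L²` with `X hh = hh` (the cut-off fixes it),
`‖G_U hh − G_V hh‖ ≤ c_G·‖hh‖`, `c_G = √(m_U⁻¹)(1 + √(m_U⁻¹))(c√(m_V⁻¹) + c₀′m_V⁻¹) + √(m_V⁻¹)(1 + √(m_V⁻¹))(c√(m_V⁻¹) + c₀″m_V⁻¹)` with the §1 constants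
`c₀′ = c + a((25κ∕4)θ′ + 2√(25κ∕8)δ_Q)`, `c₀″ = c + a(25κ∕4)θ′` (`+ 2√(25κ∕8)·0`), `δ_Q = √(2κ)(9000L²ε₀ + 2δ_V + 2δ_U)` — 2b-door's `hRB1`.
[cite: Balaban1985BackgroundPropagators, Thm 3.3 p.399, (3.49) p.399, (3.100)-(3.105) pp.413-414; Balaban1985Averaging, (97) p.32] -/
theorem norm_massiveInv_sub_le_of_cutoff_fixed (χ : Site (F.P K) 0 → ℝ) (χc : Site (F.P K) (K - n) → ℝ) {θ θ' δ : ℝ} (hθ : 0 ≤ θ) (hθ' : 0 ≤ θ') (hδ : 0 ≤ δ)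
    (hχ1 : ∀ x, |χ x| ≤ 1) (hχ : ∀ (x : Site (F.P K) 0) (μ : Fin 3), |χ (x.shift μ) - χ x| ≤ θ)
    (hχblk : ∀ x : Site (F.P K) 0, |χ x - χc (iterBlockOf (K - n) x)| ≤ θ')
    (hUV : ∀ b : PBond (F.P K) 0, (χ b.tgt ≠ 0 ∨ χ b.src ≠ 0) →
      ‖((bgUnits F K U b : (Matrix (Fin 2) (Fin 2) ℂ)ˣ) : Matrix (Fin 2) (Fin 2) ℂ) - ((bgUnits F K V b : (Matrix (Fin 2) (Fin 2) ℂ)ˣ) : Matrix (Fin 2) (Fin 2) ℂ)‖ ≤ δ * eta F n K)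
    {δV δU : ℝ} (hδV : 0 ≤ δV) (hδU : 0 ≤ δU)
    (hCV : ∀ Y : Site (F.P K) (K - n), (∃ x ∈ iterBlock (K - n) Y, χ x ≠ 0) → ∀ x ∈ iterBlock (K - n) Y, ‖(((axialT (bgUnits F K V) (Site.fibreSite 0 (K - n) (iterBlockOf (K - n) x) fun _ => (⟨0, pow_pos (F.P K).L_pos (K - n)⟩ : Fin ((F.P K).L ^ (K - n)))) (embIter (K - n) Y))⁻¹ *
          axialT (bgUnits F K V) (Site.fibreSite 0 (K - n) (iterBlockOf (K - n) x) fun _ => (⟨0, pow_pos (F.P K).L_pos (K - n)⟩ : Fin ((F.P K).L ^ (K - n)))) x : (Matrix (Fin 2) (Fin 2) ℂ)ˣ) : Matrix (Fin 2) (Fin 2) ℂ) - 1‖ ≤ δV)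
    (hCU : ∀ Y : Site (F.P K) (K - n), (∃ x ∈ iterBlock (K - n) Y, χ x ≠ 0) → ∀ x ∈ iterBlock (K - n) Y, ‖(((axialT (bgUnits F K U) (Site.fibreSite 0 (K - n) (iterBlockOf (K - n) x) fun _ => (⟨0, pow_pos (F.P K).L_pos (K - n)⟩ : Fin ((F.P K).L ^ (K - n)))) (embIter (K - n) Y))⁻¹ *
          axialT (bgUnits F K U) (Site.fibreSite 0 (K - n) (iterBlockOf (K - n) x) fun _ => (⟨0, pow_pos (F.P K).L_pos (K - n)⟩ : Fin ((F.P K).L ^ (K - n)))) x : (Matrix (Fin 2) (Fin 2) ℂ)ˣ) : Matrix (Fin 2) (Fin 2) ℂ) - 1‖ ≤ δU)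
    {a : ℝ} (ha : 0 ≤ a)
    (X : SiteL2K ℂ 3 (periodsT3 F K) c₀ W₂ →ₗ[ℂ] SiteL2K ℂ 3 (periodsT3 F K) c₀ W₂) (hX : ∀ l : Site (F.P K) 0 → Matrix (Fin 2) (Fin 2) ℂ, X (toL2S F K c₀ l) = toL2S F K c₀ (fun x => χ x • l x))
    (AU AV GU GV : SiteL2K ℂ 3 (periodsT3 F K) c₀ W₂ →ₗ[ℂ] SiteL2K ℂ 3 (periodsT3 F K) c₀ W₂)
    (hAV : ∀ w, AV w = covLapSite F n K c₀ V w + (a : ℂ) • T (ι (Q'' w)))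
    (hAU : ∀ w, AU w = covLapSite F n K c₀ U w + (a : ℂ) • TU (ι (QU w)))
    (hUG : ∀ v, AU (GU v) = v) (hAG : ∀ v, AV (GV v) = v) (hGA : ∀ v, GU (AU v) = v) (hGAV : ∀ v, GV (AV v) = v)
    {mU mV : ℝ} (hmU : 0 < mU) (hmV : 0 < mV)
    (hcoU : ∀ u : SiteL2K ℂ 3 (periodsT3 F K) c₀ W₂, mU * ‖u‖ ^ 2 ≤ RCLike.re ⟪u, AU u⟫_ℂ) (hcoV : ∀ u : SiteL2K ℂ 3 (periodsT3 F K) c₀ W₂, mV * ‖u‖ ^ 2 ≤ RCLike.re ⟪u, AV u⟫_ℂ)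
    (henergyU : ∀ w : SiteL2K ℂ 3 (periodsT3 F K) c₀ W₂, ‖DL2 F n K c₀ U w‖ ^ 2 ≤ RCLike.re ⟪w, AU w⟫_ℂ) (henergy : ∀ w : SiteL2K ℂ 3 (periodsT3 F K) c₀ W₂, ‖DL2 F n K c₀ V w‖ ^ 2 ≤ RCLike.re ⟪w, AV w⟫_ℂ)
    (hh : SiteL2K ℂ 3 (periodsT3 F K) c₀ W₂) (hXh : X hh = hh) :
    ‖GU hh - GV hh‖
      ≤ (Real.sqrt mU⁻¹ * (1 + Real.sqrt mU⁻¹) * ((Real.sqrt 3 * (eta F n K)⁻¹ * θ + Real.sqrt 24 * δ + 2 * (Real.sqrt 3 * (eta F n K)⁻¹ * θ) * (Real.sqrt 24 * δ)) * Real.sqrt mV⁻¹ + ((Real.sqrt 3 * (eta F n K)⁻¹ * θ + Real.sqrt 24 * δ + 2 * (Real.sqrt 3 * (eta F n K)⁻¹ * θ) * (Real.sqrt 24 * δ)) + a * ((25 / 4) * (c₁ * ((((F.P K).L : ℝ) ^ (F.P K).d) ^ (K - n))⁻¹ / c₀) * θ' + 2 * Real.sqrt ((25 / 8) * (c₁ *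 ((((F.P K).L : ℝ) ^ (F.P K).d) ^ (K - n))⁻¹ / c₀)) * (Real.sqrt (2 * (c₁ * ((((F.P K).L : ℝ) ^ (F.P K).d) ^ (K - n))⁻¹ / c₀)) * (2 * (4500 * (F.L : ℝ) ^ 2 * ε₀) + 2 * δV + 2 * δU)))) * mV⁻¹)
          + Real.sqrt mV⁻¹ * (1 + Real.sqrt mV⁻¹) * ((Real.sqrt 3 * (eta F n K)⁻¹ * θ + Real.sqrt 24 * δ + 2 * (Real.sqrt 3 * (eta F n K)⁻¹ * θ) * (Real.sqrt 24 * δ)) * Real.sqrt mV⁻¹ + ((Real.sqrt 3 * (eta F n K)⁻¹ * θ + Real.sqrt 24 * δ + 2 * (Real.sqrt 3 * (eta F n K)⁻¹ * θ) * (Real.sqrt 24 * δ)) + a * ((25 / 4) * (c₁ * ((((F.P K).L : ℝ) ^ (F.P K).d) ^ (K - n))⁻¹ / c₀) * θ' + 2 * Real.sqrt ((25 / 8) * (c₁ * ((((F.P K).L : ℝ) ^ (F.P K).d) ^ (K - n))⁻¹ / c₀)) * 0)) * mV⁻¹)) * ‖hh‖ := by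
  have hc₀ : 0 < c₀ := Fact.out
  have hc₁ : 0 < c₁ := Fact.out
  have hη : 0 < eta F n K := T3SectALandauChart.eta_pos F n K
  have hL := (F.P K).L_pos
  have hc : 0 ≤ (Real.sqrt 3 * (eta F n K)⁻¹ * θ + Real.sqrt 24 * δ + 2 * (Real.sqrt 3 * (eta F n K)⁻¹ * θ) * (Real.sqrt 24 * δ)) := by positivity
  have hc0' : 0 ≤ ((Real.sqrt 3 * (eta F n K)⁻¹ * θ + Real.sqrt 24 * δ + 2 * (Real.sqrt 3 * (eta F n K)⁻¹ * θ) * (Real.sqrt 24 * δ)) + a * ((25 / 4) * (c₁ * ((((F.P K).L : ℝ) ^ (F.P K).d) ^ (K - n))⁻¹ / c₀) * θ' + 2 * Real.sqrt ((25 / 8) * (c₁ * ((((F.P K).L : ℝ) ^ (F.P K).d) ^ (K - n))⁻¹ / c₀)) * (Real.sqrt (2 * (c₁ * ((((F.P K).L : ℝ) ^ (F.P K).d) ^ (K - n))⁻¹ / c₀)) * (2 * (4500 * (F.L : ℝ) ^ 2 * ε₀) + 2 * δV + 2 * δU)))) := by positivity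
  have hc0'' : 0 ≤ ((Real.sqrt 3 * (eta F n K)⁻¹ * θ + Real.sqrt 24 * δ + 2 * (Real.sqrt 3 * (eta F n K)⁻¹ * θ) * (Real.sqrt 24 * δ)) + a * ((25 / 4) * (c₁ * ((((F.P K).L : ℝ) ^ (F.P K).d) ^ (K - n))⁻¹ / c₀) * θ' + 2 * Real.sqrt ((25 / 8) * (c₁ * ((((F.P K).L : ℝ) ^ (F.P K).d) ^ (K - n))⁻¹ / c₀)) * 0)) := by positivity
  exact norm_inv_sub_inv_le_of_cutoff_fixed AU AV GU GV X (DL2 F n K c₀ U) (DL2 F n K c₀ V) hUG hAG hGA hGAV hmU hmV hcoU hcoV henergyU henergy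
    hc hc0' hc hc0''
    (hform_massive F h hε₀ hε7 V hreg Q'' hseq ι hι T hT U hregU QU hseqU TU hTU χ χc hθ hθ' hδ hχ1 hχ hχblk hUV hδV hδU hCV hCU ha X hX AU AV hAV hAU)
    (hform_massive_self F h hε₀ hε7 V hreg Q'' hseq ι hι T hT χ χc hθ hθ' hδ hχ1 hχ hχblk ha X hX AV hAV) hh hXh

end Summit.QuantumFields.YangMills.Theorems.Prop7PropagatorComparisonOnCutoff
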